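import Mathlib

/-!
# The parabola-free family at `p = 13`: the Paley-coclique lift attains `α₁₃ = 39`

Siege-plan (round 2) registered sub-stub `stub_parabolaFreeAt_13_39` of the crux `LevelOneGL2Designs`
(stmt-MatrixMultiplication-14080), family B of the plan's DECOMPOSITIONS.md: a set
`T ⊆ ℤ/13 × ℤ/13` of parameters `(a, r)` of flags of the parabola pencil `y = x² + r` is
*parabola-free* when `(a' − a)² = r − r'` forces `a' = a`; such a `T` lifts to a dot-product design
of the same size (`TangencyRandAlg.pencil_srs` is the special case `T = univ ×ˢ R` with `R` a Paley
coclique).  The plan's exact value is `α₁₃ = 39` (its kit j018863, branch and bound); the witness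
is the STRUCTURED one: `T = ℤ/13 × {2, 4, 9}`, since `{2, 4, 9}` is a coclique of the Paley graph
`P₁₃` (its six non-zero differences `±2, ±5, ±7` are the non-squares `2, 5, 6, 7, 8, 11 mod 13`).
So at `p = 13` nothing parabola-free beats the Paley lift `p · α(P₁₃) = 13 · 3` — an exact small
instance of the square-root barrier recorded in this seat's AXIS.md §2.  Kernel `decide`; no
definitions. (Wall-breaker axis k12: random-algebraic constructions with certified small instances.)
-/

set_option linter.dupNamespace false

namespace Summit.MatrixMultiplication.MatrixMultiplication.Theorems.LevelOneGL2Designs.TangencyRandAlg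

/-- **`α₁₃ ≥ 39` by the Paley coclique `{2,4,9}`** (registered sub-stub `stub_parabolaFreeAt_13_39`,
verbatim): `T = univ ×ˢ {2, 4, 9} ⊆ ℤ/13 × ℤ/13` has `39` elements and is parabola-free — for
`r = r'` the hypothesis reads `(a' − a)² = 0`, and for `r ≠ r'` in `{2,4,9}` the difference `r − r'`
is a non-square, never a value of `(a' − a)²`. [computational certificate, kernel `decide`] -/
theorem stub_parabolaFreeAt_13_39 :
    ∃ T : Finset (ZMod 13 × ZMod 13), 39 ≤ T.card ∧
      ∀ t ∈ T, ∀ t' ∈ T, (t'.1 - t.1) ^ 2 = t.2 - t'.2 → t'.1 = t.1 :=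
  ⟨Finset.univ ×ˢ ({2, 4, 9} : Finset (ZMod 13)), by decide +kernel, by decide +kernel⟩

end Summit.MatrixMultiplication.MatrixMultiplication.Theorems.LevelOneGL2Designs.TangencyRandAlg
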